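import Mathlib
import Literature.Probability.Percolation.ArmPatternsFourArm
import Literature.Probability.Percolation.KestenScaling
import Literature.Probability.Percolation.OneArmLSW
import Literature.Probability.LatticeModels.TriangularLatticeProofs
import Summits.CriticalPhenomena.CardyFormulaZ2.Theorems.CardyMagicRigidityMagicFormulaTLatticeReflection
import HarnessLib

/-!
# Ribbon rarity, part 1/2: reflected four-arm events at skeleton points (crux `MagicFormulaT`, stub R)

Crux `Summit.CriticalPhenomena.CardyFormulaZ2.Theses.CardyMagicRigidity.MagicFormulaT`
(stmt-CriticalPhenomena-4836), line `Sketch`, skeleton v7 (lead c3).  The Peierls bound for RIBBON RARITY (no two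
distinct macroscopic interface loops of critical site percolation on `δ𝕋` are globally `2ε`-close) charges, at
every point `w i` of a coarse skeleton path along one of the loops, the event that the configuration REFLECTED
through a mesh site `c i` next to `w i` has four alternating arms across the hexagonal annulus
`Λ_{r₂} ∖ Λ_{r₁}` (`ribbon_armsAt`).  This file records the measure theory of these events
`{ω | (c − ·) '' ω ∈ altFourArm r₁ r₂}`:

* `rr_measure_reflectArm` — they have the probability of `altFourArm r₁ r₂` (point reflections preserve `P_{1/2}`,
  `measurePreserving_reflect`), which is `≤ critFourArmProb r₁ r₂` (`rr_real_reflectArm_le`, via the tree's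
  `real_altFourArm_le_critFourArmProb`);
* `rr_determinedBy_reflectArm` — they are determined by the reflected annulus of sites;
* `rr_disjoint_sites` — for skeleton points `(M−1)ε` apart and `δ r₂ ≤ Mε/4` these site sets are disjoint, so
* `rr_real_iInter_reflectArm` — along a separated skeleton path the events are independent:
  `P(⋂ᵢ Eᵢ) = P(altFourArm r₁ r₂)^{k+1}` (registered sub-goal of `stub_ribbonRarity`).
-/

noncomputable section

namespace Summit.CriticalPhenomena.CardyFormulaZ2.Cruxes.MagicFormulaT.LineSketch

open MeasureTheory Set
open Literature.Probability.Percolation Literature.Probability.LatticeModels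

/-- The reflected four-arm event is measurable. -/
theorem rr_measurableSet_reflectArm (c : Site 2) {r₁ r₂ : ℕ} (h : r₁ ≤ r₂) :
    MeasurableSet {ω : SiteConfig (Site 2) | (Equiv.subLeft c) '' ω ∈ altFourArm r₁ r₂} :=
  (measurableSet_altFourArm h).preimage (SiteConfig.relabel (Equiv.subLeft c)).measurable

/-- The reflected four-arm event has the probability of `altFourArm r₁ r₂` (reflection invariance of `P_{1/2}`). -/
theorem rr_measure_reflectArm (c : Site 2) {r₁ r₂ : ℕ} (h : r₁ ≤ r₂) :
    triSitePercolation half {ω : SiteConfig (Site 2) | (Equiv.subLeft c) '' ω ∈ altFourArm r₁ r₂} =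
      triSitePercolation half (altFourArm r₁ r₂) :=
  (measurePreserving_reflect c half).measure_preimage (measurableSet_altFourArm h).nullMeasurableSet

/-- The reflected four-arm event has probability `≤ critFourArmProb r₁ r₂`. -/
theorem rr_real_reflectArm_le (c : Site 2) {r₁ r₂ : ℕ} (h : r₁ ≤ r₂) :
    (triSitePercolation half).real {ω : SiteConfig (Site 2) | (Equiv.subLeft c) '' ω ∈ altFourArm r₁ r₂} ≤
      critFourArmProb r₁ r₂ := by
  rw [measureReal_def, rr_measure_reflectArm c h, ← measureReal_def]
  exact real_altFourArm_le_critFourArmProb r₁ r₂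

/-- The reflected four-arm event is determined by the reflected annulus of sites. -/
theorem rr_determinedBy_reflectArm (c : Site 2) {r₁ r₂ : ℕ} (h : r₁ ≤ r₂) :
    DeterminedBy {ω : SiteConfig (Site 2) | (Equiv.subLeft c) '' ω ∈ altFourArm r₁ r₂}
      ↑((triAnnulus r₁ r₂).image (Equiv.subLeft c)) := by
  rw [determinedBy_iff]
  intro ω ω' hωω'
  have hA := (determinedBy_iff _ _).1 (determinedBy_altFourArm h)
  simp only [Set.mem_setOf_eq]
  apply hA
  ext x
  simp only [Set.mem_inter_iff, mem_image_subLeft_iff, Finset.mem_coe]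
  have hx := Set.ext_iff.1 hωω' (c - x)
  simp only [Set.mem_inter_iff, Finset.coe_image, Set.mem_image, Finset.mem_coe, Equiv.subLeft_apply] at hx
  constructor
  · rintro ⟨h1, h2⟩
    exact ⟨(hx.1 ⟨h1, x, h2, by abel⟩).1, h2⟩
  · rintro ⟨h1, h2⟩
    exact ⟨(hx.2 ⟨h1, x, h2, by abel⟩).1, h2⟩

/-- A site of the reflected annulus lies within `δ r₂ + 2δ` of the skeleton point. -/
theorem rr_dist_site_le {δ : ℝ} (hδ : 0 < δ) {r₁ r₂ : ℕ} {c y : Site 2} {z : ℂ}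
    (hy : y ∈ triAnnulus r₁ r₂) (hz : dist (triMeshPoint δ c) z ≤ 2 * δ) :
    dist (triMeshPoint δ (c - y)) z ≤ δ * r₂ + 2 * δ := by
  have h1 : dist (triMeshPoint δ (c - y)) (triMeshPoint δ c) ≤ δ * r₂ := by
    rw [dist_eq_norm]
    have : triMeshPoint δ (c - y) - triMeshPoint δ c = -((δ : ℂ) * triEmbed y) := by
      simp only [triMeshPoint, triEmbed_sub]; ring
    rw [this, norm_neg, norm_mul, Complex.norm_real, Real.norm_eq_abs, abs_of_pos hδ]
    have hyn : (triNorm y : ℝ) ≤ r₂ := by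
      have := (mem_triAnnulus.1 hy).2
      exact_mod_cast this
    exact mul_le_mul_of_nonneg_left ((norm_triEmbed_le_triNorm y).trans hyn) hδ.le
  calc dist (triMeshPoint δ (c - y)) z ≤ dist (triMeshPoint δ (c - y)) (triMeshPoint δ c) + dist (triMeshPoint δ c) z :=
        dist_triangle _ _ _
    _ ≤ δ * r₂ + 2 * δ := add_le_add h1 hz

/-- **Separated skeleton points carry disjoint reflected annuli** (`(M−1)ε` apart, `δ r₂ ≤ Mε/4`, `100δ ≤ ε`). -/
theorem rr_disjoint_sites {δ ε : ℝ} {M r₁ r₂ : ℕ} {z z' : ℂ} {c c' : Site 2} (hδ : 0 < δ)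
    (hδε : 100 * δ ≤ ε) (hM : 4 ≤ M) (hr₂ : δ * r₂ ≤ M * ε / 4)
    (hz : dist (triMeshPoint δ c) z ≤ 2 * δ) (hz' : dist (triMeshPoint δ c') z' ≤ 2 * δ)
    (hzz' : ((M : ℝ) - 1) * ε ≤ dist z z') :
    Disjoint ((triAnnulus r₁ r₂).image (Equiv.subLeft c)) ((triAnnulus r₁ r₂).image (Equiv.subLeft c')) := by
  rw [Finset.disjoint_left]
  intro s hs hs'
  rw [Finset.mem_image] at hs hs'
  obtain ⟨y, hy, rfl⟩ := hs
  obtain ⟨y', hy', hyy'⟩ := hs'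
  simp only [Equiv.subLeft_apply] at hyy'
  have h1 : dist (triMeshPoint δ (c - y)) z ≤ δ * r₂ + 2 * δ := rr_dist_site_le hδ hy hz
  have h2 : dist (triMeshPoint δ (c' - y')) z' ≤ δ * r₂ + 2 * δ := rr_dist_site_le hδ hy' hz'
  rw [hyy'] at h2
  have hM' : (4 : ℝ) ≤ M := by exact_mod_cast hM
  have hε : 0 < ε := by linarith
  have key : dist z z' ≤ 2 * (δ * r₂ + 2 * δ) := by
    calc dist z z' ≤ dist z (triMeshPoint δ (c - y)) + dist (triMeshPoint δ (c - y)) z' := dist_triangle _ _ _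
      _ ≤ (δ * r₂ + 2 * δ) + (δ * r₂ + 2 * δ) := by rw [dist_comm] at h1; exact add_le_add h1 h2
      _ = 2 * (δ * r₂ + 2 * δ) := by ring
  nlinarith

/-- **Independence along a separated skeleton path** (registered sub-goal `rr_real_iInter_reflectArm`): the
reflected four-arm events at pairwise `(M−1)ε`-separated skeleton points are independent under `P_{1/2}`, so the
probability of their intersection is `P(altFourArm r₁ r₂)^{k+1}`. -/
theorem rr_real_iInter_reflectArm : ∀ (δ ε : ℝ) (M r₁ r₂ k : ℕ) (w : Fin (k + 1) → ℂ) (c : Fin (k + 1) → Site 2), 0 < δ → 100 * δ ≤ ε → 4 ≤ M → δ * r₂ ≤ M * ε / 4 → r₁ ≤ r₂ → (∀ i, dist (triMeshPoint δ (c i)) (w i) ≤ 2 * δ) → (∀ i j, i ≠ j → ((M : ℝ) - 1) * ε ≤ dist (w i) (w j)) → (triSitePercolation half).real (⋂ i, {ω : SiteConfig (Site 2) | (Equiv.subLeft (c i)) '' ω ∈ altFourArm r₁ r₂}) = (triSitePercolation half).real (altFourArm r₁ r₂) ^ (k + 1) := by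
  intro δ ε M r₁ r₂ k w c hδ hδε hM hr₂ h12 hc hsep
  classical
  set cN : ℕ → Site 2 := fun j ↦ if h : j < k + 1 then c ⟨j, h⟩ else c 0 with hcN
  have hcN_of : ∀ i : Fin (k + 1), cN i = c i := by
    intro i
    simp only [hcN, dif_pos i.isLt, Fin.eta]
  have hset : (⋂ i, {ω : SiteConfig (Site 2) | (Equiv.subLeft (c i)) '' ω ∈ altFourArm r₁ r₂}) =
      ⋂ j < k + 1, {ω : SiteConfig (Site 2) | (Equiv.subLeft (cN j)) '' ω ∈ altFourArm r₁ r₂} := by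
    ext ω
    simp only [Set.mem_iInter, Set.mem_setOf_eq]
    constructor
    · intro hω j hj
      have := hω ⟨j, hj⟩
      rwa [hcN_of ⟨j, hj⟩]
    · intro hω i
      have := hω i i.isLt
      rwa [hcN_of i] at this
  rw [hset]
  have hprod := sitePercolation_real_iInter_eq_prod (V := Site 2) half
    (Y := fun j ↦ {ω : SiteConfig (Site 2) | (Equiv.subLeft (cN j)) '' ω ∈ altFourArm r₁ r₂})
    (F := fun j ↦ (triAnnulus r₁ r₂).image (Equiv.subLeft (cN j))) (N := k + 1)
    (fun j _ ↦ rr_determinedBy_reflectArm (cN j) h12)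
    (fun i j hij hj ↦ by
      have hi : i < k + 1 := hij.trans hj
      have hne : (⟨i, hi⟩ : Fin (k + 1)) ≠ ⟨j, hj⟩ := by
        intro h; exact absurd (Fin.mk.inj_iff.1 h) (Nat.ne_of_lt hij)
      have e1 : cN i = c ⟨i, hi⟩ := hcN_of ⟨i, hi⟩
      have e2 : cN j = c ⟨j, hj⟩ := hcN_of ⟨j, hj⟩
      rw [e1, e2]
      exact rr_disjoint_sites hδ hδε hM hr₂ (hc ⟨i, hi⟩) (hc ⟨j, hj⟩) (hsep _ _ hne))
  change (sitePercolation (Site 2) half).real _ = (sitePercolation (Site 2) half).real _ ^ (k + 1)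
  rw [hprod]
  rw [Finset.prod_congr rfl (fun j _ ↦ show (sitePercolation (Site 2) half).real
      {ω : SiteConfig (Site 2) | (Equiv.subLeft (cN j)) '' ω ∈ altFourArm r₁ r₂} =
      (sitePercolation (Site 2) half).real (altFourArm r₁ r₂) from by
        rw [measureReal_def, measureReal_def]
        exact congrArg ENNReal.toReal (rr_measure_reflectArm (cN j) h12))]
  rw [Finset.prod_const, Finset.card_range]

end Summit.CriticalPhenomena.CardyFormulaZ2.Cruxes.MagicFormulaT.LineSketch

end
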